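import Mathlib
import HarnessLib
import Literature.MathematicalPhysics.KineticTheory.VelocityFlipNoise
import Literature.MathematicalPhysics.KineticTheory.VelocityFlipEmbeddedChainSteadyState
import Literature.Probability.Process.HarrisTheorem
import Summits.AtomisticToContinuum.FouriersLaw.Theorems.BondHeatUncertaintySubdiffusiveBondHeatKernelGibbsE
import Summits.AtomisticToContinuum.FouriersLaw.Theorems.JunctionLocalitySuperadditiveResistanceStubBypassBoundAux2
import Summits.AtomisticToContinuum.FouriersLaw.Theorems.VanishingNoiseTransferVanishingNoiseBoundFlipMildContinuityPoisson

/-!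
# The pairing estimate for the difference of two centred mild forward fields
(helper for stub CONT `stub_flipMildContinuity`, line `fekete-usc-one-length`, crux stmt-AtomisticToContinuum-11976)

`--supports stmt-AtomisticToContinuum-11976` helper file (crux `VanishingNoiseBound`, route `VanishingNoiseTransfer`,
line `fekete-usc-one-length`, stub CONT, wave 5). Steps (2) and (4) of the perturbation argument of CONT, at FIXED bath
temperatures `(T_L, T_R)` and with the δ-uniform inputs as hypotheses: for `pinnedChain ω₂ lam β γ` (all parameters
`> 0`), `N ≥ 2`, `T, ε > 0`, the resolvent kernels `R`, `R⁰` of the flip-free dynamics at `(T_L, T_R)` and `(T, T)` at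
rate `r = Nε` and the embedded flip chain `K = Q ∘ₖ R`:

* `abs_flipAverage_le` — the flip average preserves `e^{ϑH}`-bounds;
* `mild_difference_pairing_le` — given Harris data for `K` (drifts `RV, KV, R⁰V ≤ γ₀V + K₀`, contraction `ᾱ` of the
  `d_{β_h}`-seminorm), two `e^{H/4T}`-bounded solutions `g₁ = R(ψ₁ + Qg₁)` (measurable), `g₀ = R⁰(ψ₀ + Qg₀)` of the
  centred mild equations (`ψ_j = r⁻¹((p_0² − T) − c_j)`) and the resolvent-difference bound `|Rf₀ − R⁰f₀| ≤ η₁ e^{θH}`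
  for `f₀ = ψ₀ + Qg₀`: `|∫ g₁(p_b² − T) dμ_T − ∫ g₀(p_b² − T) dμ_T| ≤ C_H (η₁ + r⁻¹|c₁ − c₀|) ∫ e^{θH}|p_b² − T| dμ_T`.
  The difference `D = g₁ − g₀` solves the Poisson-type equation `D = KD + E`, `E = (R − R⁰)f₀ − r⁻¹(c₁ − c₀)`;
  `poisson_lipschitz_le` + `abs_sub_integral_le_of_lipschitz` (`…FlipMildContinuityPoisson`) with the invariant law `π`
  of `K` bound `D − π(D)` in the weighted norm, and `π(D)` pairs to `0` by equipartition (`pinnedChain_integral_snd_sq`);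
* `helper_flipMildContinuityDifference` — registered helper (notation-free restatement of `abs_flipAverage_le`; the main
  statement exceeds the one-line registration limit).

References: Hairer–Mattingly 2011 Thm 1.3; Meyn–Tweedie Ch. 17; Bernardin–Olla 2011 §2.1.
-/

noncomputable section

open MeasureTheory ProbabilityTheory Filter Topology Set
open scoped NNReal ENNReal Topology
open Literature.MathematicalPhysics.KineticTheory.HeatConduction Literature.Probability.Process OscillatorChain
open Summit.AtomisticToContinuum.FouriersLaw.Theorems.SubdiffusiveBondHeat (abs_sq_momentum_sub_le_exp)
open Summit.AtomisticToContinuum.FouriersLaw.Cruxes.SuperadditiveResistance.FloatingProbeBypassLaplacian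
  (pinnedChain_memLp_two_snd pinnedChain_integral_snd_sq)

namespace Summit.AtomisticToContinuum.FouriersLaw.Theorems.VanishingNoiseBound

variable {ω₂ lam β γ : ℝ} {N : ℕ}

/-- The flip average `Q h = N⁻¹ Σ_i h ∘ F_i` of an `e^{ϑH}`-bounded function is `e^{ϑH}`-bounded with the same
constant (`H ∘ F_i = H`). [folklore] -/
theorem abs_flipAverage_le (hN : 0 < N) {h : PhaseSpace N → ℝ} {C ϑ : ℝ}
    (hb : ∀ z, |h z| ≤ C * Real.exp (ϑ * (pinnedChain ω₂ lam β γ).hamiltonian N z)) (y : PhaseSpace N) :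
    |(N : ℝ)⁻¹ * ∑ i : Fin N, h (momentumFlip i y)| ≤ C * Real.exp (ϑ * (pinnedChain ω₂ lam β γ).hamiltonian N y) := by
  rw [abs_mul, abs_of_pos (by positivity : (0 : ℝ) < (N : ℝ)⁻¹)]
  calc (N : ℝ)⁻¹ * |∑ i : Fin N, h (momentumFlip i y)| ≤ (N : ℝ)⁻¹ * ∑ i : Fin N, |h (momentumFlip i y)| :=
        mul_le_mul_of_nonneg_left (Finset.abs_sum_le_sum_abs _ _) (by positivity)
    _ ≤ (N : ℝ)⁻¹ * ∑ _i : Fin N, C * Real.exp (ϑ * (pinnedChain ω₂ lam β γ).hamiltonian N y) := by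
        refine mul_le_mul_of_nonneg_left (Finset.sum_le_sum fun i _ => ?_) (by positivity)
        have := hb (momentumFlip i y); rwa [OscillatorChain.hamiltonian_momentumFlip] at this
    _ = C * Real.exp (ϑ * (pinnedChain ω₂ lam β γ).hamiltonian N y) := by
        rw [Finset.sum_const, Finset.card_univ, Fintype.card_fin, nsmul_eq_mul]
        field_simp

set_option maxHeartbeats 1600000 in
/-- **The pairing estimate for the difference of two centred mild forward fields.** Fix `pinnedChain ω₂ lam β γ` (all
parameters `> 0`), `N ≥ 2`, a reference temperature `T > 0`, a flip rate `ε > 0` (`r = Nε`), bath temperatures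
`T_L, T_R > 0`, a weight `1/(4T) ≤ θ < min(1/T, 1/max(T_L,T_R))`, `V = e^{θH}`, the resolvent kernels `R`, `R⁰` of the
flip-free dynamics at `(T_L, T_R)` and `(T, T)` and the embedded flip chain `K = Q ∘ₖ R`. Assume Harris data for `K`:
drifts `RV, KV, R⁰V ≤ γ₀V + K₀` (`γ₀ < 1`) and the contraction `⦀Kφ⦀ ≤ ᾱ⦀φ⦀` of the `d_{β_h}`-seminorm (`ᾱ ∈ (0,1)`,
`β_h > 0`). Let `g₁` (measurable) and `g₀` be `e^{H/4T}`-bounded solutions of the centred mild equations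
`g₁ = R(ψ₁ + Qg₁)`, `g₀ = R⁰(ψ₀ + Qg₀)`, `ψ_j = r⁻¹((p_0² − T) − c_j)`, and assume the resolvent-difference bound
`|R f₀ − R⁰ f₀| ≤ η₁ V` for `f₀ = ψ₀ + Qg₀`. Then for every site `b`,
`|∫ g₁ (p_b² − T) dμ_T − ∫ g₀ (p_b² − T) dμ_T| ≤ C_H (η₁ + r⁻¹|c₁ − c₀|) ∫ V |p_b² − T| dμ_T` with
`C_H = (2 + β_h + β_h K₀/(1−γ₀))/(β_h(1−ᾱ))`. Proof: `D = g₁ − g₀` solves `D = KD + E`,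
`E = (R − R⁰)f₀ − r⁻¹(c₁ − c₀)`, `|E| ≤ (η₁ + r⁻¹|c₁−c₀|)V`; `poisson_lipschitz_le` and
`abs_sub_integral_le_of_lipschitz` (invariant law `π` of `K`, `π(V) ≤ K₀/(1−γ₀)`) bound `|D − π(D)| ≤ C_H(…)V`, and the
constant `π(D)` pairs to `0` by equipartition. [cite: HairerMattingly2011, Theorem 1.3] -/
theorem mild_difference_pairing_le (hω : 0 < ω₂) (hl : 0 < lam) (hβ : 0 < β) (hγ : 0 < γ) (hN : 1 < N)
    {T : ℝ} (hT : 0 < T) {ε : ℝ} (hε : 0 < ε) {T_L T_R : ℝ} (hTL : 0 < T_L) (hTR : 0 < T_R)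
    {θ : ℝ} (hθ1 : 1 / (4 * T) ≤ θ) (hθT : θ < 1 / T) (hθLR : θ < 1 / max T_L T_R)
    {γ₀ K₀ : ℝ≥0} {abar βh : ℝ} (hγ₀ : γ₀ < 1) (habar0 : 0 < abar) (habar1 : abar < 1) (hβh : 0 < βh)
    (hdR : ∀ z : PhaseSpace N,
      ∫⁻ y, ((Real.exp (θ * (pinnedChain ω₂ lam β γ).hamiltonian N y)).toNNReal : ℝ≥0∞)
          ∂((pinnedChainSemigroup hω hl.le hβ.le hγ.le (Nat.zero_lt_of_lt hN) hTL.le hTR.le).resolventKernel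
            ((N : ℝ) * ε) z) ≤
        (γ₀ : ℝ≥0∞) * ((Real.exp (θ * (pinnedChain ω₂ lam β γ).hamiltonian N z)).toNNReal : ℝ≥0∞) + K₀)
    (hdK : ∀ z : PhaseSpace N,
      ∫⁻ y, ((Real.exp (θ * (pinnedChain ω₂ lam β γ).hamiltonian N y)).toNNReal : ℝ≥0∞)
          ∂((pinnedChainSemigroup hω hl.le hβ.le hγ.le (Nat.zero_lt_of_lt hN) hTL.le hTR.le).embeddedFlipKernel
            ((N : ℝ) * ε) z) ≤
        (γ₀ : ℝ≥0∞) * ((Real.exp (θ * (pinnedChain ω₂ lam β γ).hamiltonian N z)).toNNReal : ℝ≥0∞) + K₀)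
    (hdR0 : ∀ z : PhaseSpace N,
      ∫⁻ y, ((Real.exp (θ * (pinnedChain ω₂ lam β γ).hamiltonian N y)).toNNReal : ℝ≥0∞)
          ∂((pinnedChainSemigroup hω hl.le hβ.le hγ.le (Nat.zero_lt_of_lt hN) hT.le hT.le).resolventKernel
            ((N : ℝ) * ε) z) ≤
        (γ₀ : ℝ≥0∞) * ((Real.exp (θ * (pinnedChain ω₂ lam β γ).hamiltonian N z)).toNNReal : ℝ≥0∞) + K₀)
    (hcontr : ∀ φ : PhaseSpace N → ℝ, Measurable φ → ∀ M : ℝ, 0 ≤ M →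
      (∀ x y, |φ x - φ y| ≤ M * (2 + βh * (Real.exp (θ * (pinnedChain ω₂ lam β γ).hamiltonian N x)).toNNReal +
          βh * (Real.exp (θ * (pinnedChain ω₂ lam β γ).hamiltonian N y)).toNNReal)) →
      ∀ x y, |∫ w, φ w ∂((pinnedChainSemigroup hω hl.le hβ.le hγ.le (Nat.zero_lt_of_lt hN) hTL.le
              hTR.le).embeddedFlipKernel ((N : ℝ) * ε) x) -
          ∫ w, φ w ∂((pinnedChainSemigroup hω hl.le hβ.le hγ.le (Nat.zero_lt_of_lt hN) hTL.le
              hTR.le).embeddedFlipKernel ((N : ℝ) * ε) y)| ≤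
        abar * M * (2 + βh * (Real.exp (θ * (pinnedChain ω₂ lam β γ).hamiltonian N x)).toNNReal +
          βh * (Real.exp (θ * (pinnedChain ω₂ lam β γ).hamiltonian N y)).toNNReal))
    {g₁ g₀ : PhaseSpace N → ℝ} {c₁ c₀ C₁ C₀ : ℝ} (hg₁m : Measurable g₁) (hg₀m : Measurable g₀)
    (hg₁b : ∀ z, |g₁ z| ≤ C₁ * Real.exp (1 / (4 * T) * (pinnedChain ω₂ lam β γ).hamiltonian N z))
    (hg₀b : ∀ z, |g₀ z| ≤ C₀ * Real.exp (1 / (4 * T) * (pinnedChain ω₂ lam β γ).hamiltonian N z))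
    (hg₁eq : ∀ z, g₁ z = ∫ y, (((N : ℝ) * ε)⁻¹ * ((y.2 ⟨0, Nat.zero_lt_of_lt hN⟩ ^ 2 - T) - c₁) +
        (N : ℝ)⁻¹ * ∑ i : Fin N, g₁ (momentumFlip i y))
      ∂((pinnedChainSemigroup hω hl.le hβ.le hγ.le (Nat.zero_lt_of_lt hN) hTL.le hTR.le).resolventKernel
        ((N : ℝ) * ε) z))
    (hg₀eq : ∀ z, g₀ z = ∫ y, (((N : ℝ) * ε)⁻¹ * ((y.2 ⟨0, Nat.zero_lt_of_lt hN⟩ ^ 2 - T) - c₀) +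
        (N : ℝ)⁻¹ * ∑ i : Fin N, g₀ (momentumFlip i y))
      ∂((pinnedChainSemigroup hω hl.le hβ.le hγ.le (Nat.zero_lt_of_lt hN) hT.le hT.le).resolventKernel
        ((N : ℝ) * ε) z))
    {η₁ : ℝ} (hη₁ : 0 ≤ η₁)
    (hdiff : ∀ z, |∫ y, (((N : ℝ) * ε)⁻¹ * ((y.2 ⟨0, Nat.zero_lt_of_lt hN⟩ ^ 2 - T) - c₀) +
          (N : ℝ)⁻¹ * ∑ i : Fin N, g₀ (momentumFlip i y))
        ∂((pinnedChainSemigroup hω hl.le hβ.le hγ.le (Nat.zero_lt_of_lt hN) hTL.le hTR.le).resolventKernel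
          ((N : ℝ) * ε) z) -
        ∫ y, (((N : ℝ) * ε)⁻¹ * ((y.2 ⟨0, Nat.zero_lt_of_lt hN⟩ ^ 2 - T) - c₀) +
          (N : ℝ)⁻¹ * ∑ i : Fin N, g₀ (momentumFlip i y))
        ∂((pinnedChainSemigroup hω hl.le hβ.le hγ.le (Nat.zero_lt_of_lt hN) hT.le hT.le).resolventKernel
          ((N : ℝ) * ε) z)| ≤ η₁ * Real.exp (θ * (pinnedChain ω₂ lam β γ).hamiltonian N z))
    (b : Fin N) :
    |∫ x, g₁ x * (x.2 b ^ 2 - T) ∂((pinnedChain ω₂ lam β γ).gibbsMeasure N T) -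
        ∫ x, g₀ x * (x.2 b ^ 2 - T) ∂((pinnedChain ω₂ lam β γ).gibbsMeasure N T)| ≤
      (2 + βh + βh * (K₀ / (1 - γ₀))) / (βh * (1 - abar)) * (η₁ + ((N : ℝ) * ε)⁻¹ * |c₁ - c₀|) *
        ∫ x, Real.exp (θ * (pinnedChain ω₂ lam β γ).hamiltonian N x) * |x.2 b ^ 2 - T|
          ∂((pinnedChain ω₂ lam β γ).gibbsMeasure N T) := by
  ------------------------------------------------------------------
  -- Step 0: notation and elementary facts
  ------------------------------------------------------------------
  have hN0 : 0 < N := Nat.zero_lt_of_lt hN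
  set P := pinnedChain ω₂ lam β γ with hP
  set Sg := pinnedChainSemigroup hω hl.le hβ.le hγ.le hN0 hTL.le hTR.le with hSg
  set S₀ := pinnedChainSemigroup hω hl.le hβ.le hγ.le hN0 hT.le hT.le with hS₀
  set r : ℝ := (N : ℝ) * ε with hr_def
  have hr : 0 < r := by positivity
  set R := Sg.resolventKernel r with hRdef
  set R₀ := S₀.resolventKernel r with hR₀def
  set K := Sg.embeddedFlipKernel r with hKdef
  haveI hRM : IsMarkovKernel R := Sg.isMarkovKernel_resolventKernel hr
  haveI hR₀M : IsMarkovKernel R₀ := S₀.isMarkovKernel_resolventKernel hr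
  haveI hKM : IsMarkovKernel K := Sg.isMarkovKernel_embeddedFlipKernel hr
  have hKeq : K = flipKernel N ∘ₖ R := Sg.embeddedFlipKernel_eq r
  set H : PhaseSpace N → ℝ := P.hamiltonian N with hH
  have hHc : Continuous H := pinnedChain_continuous_hamiltonian ω₂ lam β γ N
  have hH0 : ∀ x, 0 ≤ H x := fun x => pinnedChain_hamiltonian_nonneg hω.le hl.le hβ.le γ N x
  set θ₁ : ℝ := 1 / (4 * T) with hθ₁
  have hθ₁0 : 0 < θ₁ := by positivity
  have hθ0 : 0 < θ := hθ₁0.trans_le hθ1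
  let V : PhaseSpace N → ℝ≥0 := fun x => (Real.exp (θ * H x)).toNNReal
  have hVc : Continuous V := continuous_real_toNNReal.comp (Real.continuous_exp.comp (continuous_const.mul hHc))
  have hVm : Measurable V := hVc.measurable
  have hVreal : ∀ x, ((V x : ℝ≥0) : ℝ) = Real.exp (θ * H x) := fun x => Real.coe_toNNReal _ (Real.exp_pos _).le
  have hVge1 : ∀ x, (1 : ℝ) ≤ V x := fun x => by rw [hVreal]; exact Real.one_le_exp (mul_nonneg hθ0.le (hH0 x))
  have hexp1V : ∀ x, Real.exp (θ₁ * H x) ≤ V x := fun x => by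
    rw [hVreal]; exact Real.exp_le_exp.2 (mul_le_mul_of_nonneg_right hθ1 (hH0 x))
  have h1a : 0 < 1 - abar := by linarith
  have hγ₀r : (γ₀ : ℝ) < 1 := by exact_mod_cast hγ₀
  have h1γ : 0 < 1 - (γ₀ : ℝ) := by linarith
  -- finiteness of `V`-moments of the kernels
  have hVR : ∀ x, ∫⁻ y, (V y : ℝ≥0∞) ∂(R x) ≠ ⊤ := fun x =>
    ne_top_of_le_ne_top (by simp [ENNReal.mul_eq_top]) (hdR x)
  have hVR₀ : ∀ x, ∫⁻ y, (V y : ℝ≥0∞) ∂(R₀ x) ≠ ⊤ := fun x =>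
    ne_top_of_le_ne_top (by simp [ENNReal.mul_eq_top]) (hdR0 x)
  have hVK : ∀ x, ∫⁻ y, (V y : ℝ≥0∞) ∂(K x) ≠ ⊤ := fun x =>
    ne_top_of_le_ne_top (by simp [ENNReal.mul_eq_top]) (hdK x)
  ------------------------------------------------------------------
  -- Step 1: the integrands and their `V`-bounds
  ------------------------------------------------------------------
  set i0 : Fin N := ⟨0, hN0⟩ with hi0
  set ψ₁ : PhaseSpace N → ℝ := fun y => r⁻¹ * ((y.2 i0 ^ 2 - T) - c₁) with hψ₁
  set ψ₀ : PhaseSpace N → ℝ := fun y => r⁻¹ * ((y.2 i0 ^ 2 - T) - c₀) with hψ₀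
  set Q₁ : PhaseSpace N → ℝ := fun y => (N : ℝ)⁻¹ * ∑ i : Fin N, g₁ (momentumFlip i y) with hQ₁
  set Q₀ : PhaseSpace N → ℝ := fun y => (N : ℝ)⁻¹ * ∑ i : Fin N, g₀ (momentumFlip i y) with hQ₀
  have hψ₁c : Continuous ψ₁ := by rw [hψ₁]; fun_prop
  have hψ₀c : Continuous ψ₀ := by rw [hψ₀]; fun_prop
  have hQ₁m : Measurable Q₁ :=
    (Finset.measurable_sum _ fun i _ => hg₁m.comp (measurable_momentumFlip i)).const_mul _
  have hQ₀m : Measurable Q₀ :=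
    (Finset.measurable_sum _ fun i _ => hg₀m.comp (measurable_momentumFlip i)).const_mul _
  have hψb : ∀ (cc : ℝ) (y : PhaseSpace N), |r⁻¹ * ((y.2 i0 ^ 2 - T) - cc)| ≤ r⁻¹ * (2 / θ₁ + T + |cc|) * V y := by
    intro cc y
    have h1 := abs_sq_momentum_sub_le_exp (γ := γ) hω hl.le hβ.le hθ₁0 hT.le y i0
    have h2 := hexp1V y
    have h3 : (1 : ℝ) ≤ V y := hVge1 y
    rw [abs_mul, abs_of_pos (inv_pos.2 hr), mul_assoc]
    refine mul_le_mul_of_nonneg_left ?_ (inv_pos.2 hr).le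
    calc |y.2 i0 ^ 2 - T - cc| ≤ |y.2 i0 ^ 2 - T| + |cc| := abs_sub _ _
      _ ≤ (2 / θ₁ + T) * Real.exp (θ₁ * H y) + |cc| * 1 := by rw [mul_one]; exact add_le_add h1 le_rfl
      _ ≤ (2 / θ₁ + T) * V y + |cc| * V y := by gcongr
      _ = (2 / θ₁ + T + |cc|) * V y := by ring
  have hQ₁b : ∀ y, |Q₁ y| ≤ 0 + |C₁| * V y := fun y => by
    rw [zero_add]
    have h := abs_flipAverage_le (ω₂ := ω₂) (lam := lam) (β := β) (γ := γ) hN0 (h := g₁) (C := C₁) (ϑ := θ₁) hg₁b y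
    refine h.trans ((mul_le_mul_of_nonneg_right (le_abs_self C₁) (Real.exp_pos _).le).trans ?_)
    exact mul_le_mul_of_nonneg_left (hexp1V y) (abs_nonneg _)
  have hQ₀b : ∀ y, |Q₀ y| ≤ 0 + |C₀| * V y := fun y => by
    rw [zero_add]
    have h := abs_flipAverage_le (ω₂ := ω₂) (lam := lam) (β := β) (γ := γ) hN0 (h := g₀) (C := C₀) (ϑ := θ₁) hg₀b y
    refine h.trans ((mul_le_mul_of_nonneg_right (le_abs_self C₀) (Real.exp_pos _).le).trans ?_)
    exact mul_le_mul_of_nonneg_left (hexp1V y) (abs_nonneg _)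
  have hψ₁b : ∀ y, |ψ₁ y| ≤ 0 + r⁻¹ * (2 / θ₁ + T + |c₁|) * V y := fun y => by rw [zero_add]; exact hψb c₁ y
  have hψ₀b : ∀ y, |ψ₀ y| ≤ 0 + r⁻¹ * (2 / θ₁ + T + |c₀|) * V y := fun y => by rw [zero_add]; exact hψb c₀ y
  -- integrability under `R x`, `R₀ x`
  have iψ₁R : ∀ x, Integrable ψ₁ (R x) := fun x => Harris.integrable_of_abs_le_affine hVm (hVR x) hψ₁c.measurable hψ₁b
  have iψ₀R : ∀ x, Integrable ψ₀ (R x) := fun x => Harris.integrable_of_abs_le_affine hVm (hVR x) hψ₀c.measurable hψ₀b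
  have iψ₀R₀ : ∀ x, Integrable ψ₀ (R₀ x) := fun x => Harris.integrable_of_abs_le_affine hVm (hVR₀ x) hψ₀c.measurable hψ₀b
  have iQ₁R : ∀ x, Integrable Q₁ (R x) := fun x => Harris.integrable_of_abs_le_affine hVm (hVR x) hQ₁m hQ₁b
  have iQ₀R : ∀ x, Integrable Q₀ (R x) := fun x => Harris.integrable_of_abs_le_affine hVm (hVR x) hQ₀m hQ₀b
  have iQ₀R₀ : ∀ x, Integrable Q₀ (R₀ x) := fun x => Harris.integrable_of_abs_le_affine hVm (hVR₀ x) hQ₀m hQ₀b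
  ------------------------------------------------------------------
  -- Step 2: the difference `D`, the operator `K D`, the defect `E` and its bound
  ------------------------------------------------------------------
  set D : PhaseSpace N → ℝ := fun x => g₁ x - g₀ x with hD
  have hDm : Measurable D := hg₁m.sub hg₀m
  have hDb : ∀ x, |D x| ≤ 0 + (|C₁| + |C₀|) * V x := fun x => by
    rw [zero_add, hD]; dsimp only
    have h1 := (hg₁b x).trans ((mul_le_mul_of_nonneg_right (le_abs_self C₁) (Real.exp_pos _).le).trans
      (mul_le_mul_of_nonneg_left (hexp1V x) (abs_nonneg _)))
    have h2 := (hg₀b x).trans ((mul_le_mul_of_nonneg_right (le_abs_self C₀) (Real.exp_pos _).le).trans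
      (mul_le_mul_of_nonneg_left (hexp1V x) (abs_nonneg _)))
    have h3 : |g₁ x - g₀ x| ≤ |g₁ x| + |g₀ x| := abs_sub _ _
    linarith
  have iDK : ∀ x, Integrable D (K x) := fun x => Harris.integrable_of_abs_le_affine hVm (hVK x) hDm hDb
  -- `K D = R(Q₁ − Q₀)`
  have hQD : ∀ y, ∫ w, D w ∂(flipKernel N y) = Q₁ y - Q₀ y := fun y => by
    rw [integral_flipKernel hN0 D y, hQ₁, hQ₀, hD]; dsimp only
    rw [← mul_sub, ← Finset.sum_sub_distrib]
  have hKD : ∀ x, ∫ y, D y ∂(K x) = ∫ y, Q₁ y ∂(R x) - ∫ y, Q₀ y ∂(R x) := by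
    intro x
    have hint : Integrable D ((flipKernel N ∘ₖ R) x) := by rw [← hKeq]; exact iDK x
    rw [show K x = (flipKernel N ∘ₖ R) x by rw [hKeq], Kernel.integral_comp hint,
      integral_congr_ae (ae_of_all _ fun y => hQD y), integral_sub (iQ₁R x) (iQ₀R x)]
  set E : PhaseSpace N → ℝ := fun x => D x - ∫ y, D y ∂(K x) with hE
  have heq : ∀ x, D x = ∫ y, D y ∂(K x) + E x := fun x => by rw [hE]; dsimp only; ring
  -- the mild equations, split
  have hg₁' : ∀ x, g₁ x = ∫ y, ψ₁ y ∂(R x) + ∫ y, Q₁ y ∂(R x) := fun x => by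
    rw [← integral_add (iψ₁R x) (iQ₁R x)]; exact hg₁eq x
  have hg₀' : ∀ x, g₀ x = ∫ y, ψ₀ y ∂(R₀ x) + ∫ y, Q₀ y ∂(R₀ x) := fun x => by
    rw [← integral_add (iψ₀R₀ x) (iQ₀R₀ x)]; exact hg₀eq x
  have hψ₁₀ : ∀ x, ∫ y, ψ₁ y ∂(R x) = ∫ y, ψ₀ y ∂(R x) - r⁻¹ * (c₁ - c₀) := fun x => by
    have h1 : ψ₁ = fun y => ψ₀ y - r⁻¹ * (c₁ - c₀) := by
      funext y; rw [hψ₁, hψ₀]; dsimp only; ring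
    rw [h1, integral_sub (iψ₀R x) (integrable_const _), integral_const, probReal_univ, one_smul]
  have hEeq : ∀ x, E x = (∫ y, (ψ₀ y + Q₀ y) ∂(R x) - ∫ y, (ψ₀ y + Q₀ y) ∂(R₀ x)) - r⁻¹ * (c₁ - c₀) := by
    intro x
    rw [hE]; dsimp only
    rw [hKD x, integral_add (iψ₀R x) (iQ₀R x), integral_add (iψ₀R₀ x) (iQ₀R₀ x)]
    have e1 : D x = g₁ x - g₀ x := rfl
    rw [e1, hg₁' x, hg₀' x, hψ₁₀ x]
    ring
  set eE : ℝ := η₁ + r⁻¹ * |c₁ - c₀| with heE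
  have heE0 : 0 ≤ eE := by positivity
  have hEb : ∀ x, |E x| ≤ eE * V x := by
    intro x
    have h1 := hdiff x
    rw [hEeq x, heE]
    have h2 : |r⁻¹ * (c₁ - c₀)| ≤ r⁻¹ * |c₁ - c₀| * V x := by
      rw [abs_mul, abs_of_pos (inv_pos.2 hr)]
      exact le_mul_of_one_le_right (by positivity) (hVge1 x)
    calc |(∫ y, (ψ₀ y + Q₀ y) ∂(R x) - ∫ y, (ψ₀ y + Q₀ y) ∂(R₀ x)) - r⁻¹ * (c₁ - c₀)|
        ≤ |∫ y, (ψ₀ y + Q₀ y) ∂(R x) - ∫ y, (ψ₀ y + Q₀ y) ∂(R₀ x)| + |r⁻¹ * (c₁ - c₀)| := abs_sub _ _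
      _ ≤ η₁ * (V x : ℝ) + r⁻¹ * |c₁ - c₀| * V x := by
          refine add_le_add ?_ h2
          rw [hVreal]; exact h1
      _ = (η₁ + r⁻¹ * |c₁ - c₀|) * V x := by ring
  ------------------------------------------------------------------
  -- Step 3: Harris/Poisson: `D` is `d_β`-Lipschitz with constant `(eE/β_h)/(1-ᾱ)`
  ------------------------------------------------------------------
  have hDlip : ∀ x y, |D x - D y| ≤ (|C₁| + |C₀|) / βh * (2 + βh * V x + βh * V y) :=
    lipschitz_of_abs_le_mul hβh (by positivity) (fun x => by have := hDb x; rwa [zero_add] at this)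
  have hElip : ∀ x y, |E x - E y| ≤ eE / βh * (2 + βh * V x + βh * V y) :=
    lipschitz_of_abs_le_mul hβh heE0 hEb
  have hDlip' := poisson_lipschitz_le K habar0.le habar1 hcontr hDm (by positivity) (by positivity) hDlip hElip
    heq hβh.le
  ------------------------------------------------------------------
  -- Step 4: the invariant law `π` of `K` and the centred bound
  ------------------------------------------------------------------
  obtain ⟨π, hπ, hinv, -⟩ := pinnedChain_exists_invariant_embeddedFlipKernel hω hl hβ hγ hN hTL hTR hr hθ0 hθLR
  haveI := hπ
  have hπV : ∫⁻ x, (V x : ℝ≥0∞) ∂π ≤ ((K₀ / (1 - γ₀) : ℝ≥0) : ℝ≥0∞) :=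
    Harris.lintegral_le_of_invariant K hVm hγ₀ hdK hinv
  have hπVtop : ∫⁻ x, (V x : ℝ≥0∞) ∂π ≠ ⊤ := ne_top_of_le_ne_top ENNReal.coe_ne_top hπV
  set mV : ℝ := ((K₀ / (1 - γ₀) : ℝ≥0) : ℝ) with hmV
  have hmV0 : 0 ≤ mV := NNReal.coe_nonneg _
  have hmVeq : mV = K₀ / (1 - γ₀) := by rw [hmV, NNReal.coe_div, NNReal.coe_sub hγ₀.le, NNReal.coe_one]
  have hπVr : (∫⁻ x, (V x : ℝ≥0∞) ∂π).toReal ≤ mV := by rw [hmV]; exact ENNReal.toReal_le_coe_of_le_coe hπV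
  set πD : ℝ := ∫ y, D y ∂π with hπD
  set CH : ℝ := (2 + βh + βh * (K₀ / (1 - γ₀))) / (βh * (1 - abar)) with hCH
  have hcent : ∀ x, |D x - πD| ≤ CH * eE * V x := by
    intro x
    have h1 := abs_sub_integral_le_of_lipschitz hVm hπVtop hDm hDlip' x
    refine h1.trans ?_
    have hV1 := hVge1 x
    have hV0 : (0 : ℝ) ≤ V x := (V x).coe_nonneg
    have e1 : eE / βh / (1 - abar) * (2 + βh * V x + βh * (∫⁻ y, (V y : ℝ≥0∞) ∂π).toReal) ≤
        eE / βh / (1 - abar) * (2 * V x + βh * V x + βh * mV * V x) := by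
      refine mul_le_mul_of_nonneg_left ?_ (by positivity)
      have p1 : βh * (∫⁻ y, (V y : ℝ≥0∞) ∂π).toReal ≤ βh * mV := mul_le_mul_of_nonneg_left hπVr hβh.le
      have p2 : βh * mV * 1 ≤ βh * mV * V x := mul_le_mul_of_nonneg_left hV1 (by positivity)
      linarith
    refine e1.trans (le_of_eq ?_)
    rw [hCH, hmVeq]
    field_simp
  ------------------------------------------------------------------
  -- Step 5: the pairing against `(p_b² − T) μ_T`
  ------------------------------------------------------------------
  set μ := P.gibbsMeasure N T with hμ
  haveI : IsProbabilityMeasure μ := pinnedChain_isProbabilityMeasure_gibbsMeasure hω hl.le hβ.le γ N hT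
  set k : PhaseSpace N → ℝ := fun x => x.2 b ^ 2 - T with hk
  have hkc : Continuous k := by rw [hk]; fun_prop
  -- the dominating function `W = V |k| ∈ L¹(μ_T)`
  set θ'' : ℝ := (1 / T - θ) / 2 with hθ''
  have hθ''0 : 0 < θ'' := by rw [hθ'']; linarith
  have hsum : θ + θ'' < 1 / T := by rw [hθ'']; linarith
  have hkb : ∀ x, |k x| ≤ (2 / θ'' + T) * Real.exp (θ'' * H x) := fun x =>
    abs_sq_momentum_sub_le_exp (γ := γ) hω hl.le hβ.le hθ''0 hT.le x b
  set W : PhaseSpace N → ℝ := fun x => (V x : ℝ) * |k x| with hW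
  have hWc : Continuous W := by
    rw [hW]; exact (NNReal.continuous_coe.comp hVc).mul (continuous_abs.comp hkc)
  have hWi : Integrable W μ := by
    have hexp := pinnedChain_integrable_exp_mul_hamiltonian_gibbsMeasure hω hl.le hβ.le γ N hT hsum
    refine (hexp.const_mul (2 / θ'' + T)).mono' hWc.aestronglyMeasurable (ae_of_all _ fun x => ?_)
    rw [Real.norm_eq_abs, hW]; dsimp only
    rw [abs_mul, abs_abs, abs_of_nonneg (V x).coe_nonneg, hVreal]
    calc Real.exp (θ * H x) * |k x| ≤ Real.exp (θ * H x) * ((2 / θ'' + T) * Real.exp (θ'' * H x)) :=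
          mul_le_mul_of_nonneg_left (hkb x) (Real.exp_pos _).le
      _ = (2 / θ'' + T) * Real.exp ((θ + θ'') * H x) := by
          rw [show (θ + θ'') * H x = θ * H x + θ'' * H x by ring, Real.exp_add]; ring
  -- integrability of the pairings
  have hint_of_le : ∀ {φ : PhaseSpace N → ℝ}, Measurable φ → ∀ A : ℝ, (∀ x, |φ x| ≤ A * V x) →
      Integrable (fun x => φ x * k x) μ := by
    intro φ hφm A hφ
    refine (hWi.const_mul A).mono' (hφm.mul hkc.measurable).aestronglyMeasurable (ae_of_all _ fun x => ?_)
    rw [Real.norm_eq_abs, abs_mul, hW]; dsimp only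
    rw [← mul_assoc]
    exact mul_le_mul_of_nonneg_right (hφ x) (abs_nonneg _)
  have iDk : Integrable (fun x => D x * k x) μ := hint_of_le hDm (|C₁| + |C₀|) (fun x => by
    have := hDb x; rwa [zero_add] at this)
  have ig₁k : Integrable (fun x => g₁ x * k x) μ := hint_of_le hg₁m |C₁| (fun x =>
    (hg₁b x).trans ((mul_le_mul_of_nonneg_right (le_abs_self C₁) (Real.exp_pos _).le).trans
      (mul_le_mul_of_nonneg_left (hexp1V x) (abs_nonneg _))))
  have ig₀k : Integrable (fun x => g₀ x * k x) μ := hint_of_le hg₀m |C₀| (fun x =>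
    (hg₀b x).trans ((mul_le_mul_of_nonneg_right (le_abs_self C₀) (Real.exp_pos _).le).trans
      (mul_le_mul_of_nonneg_left (hexp1V x) (abs_nonneg _))))
  have ick : Integrable (fun x => πD * k x) μ := hint_of_le measurable_const |πD| (fun x =>
    le_mul_of_one_le_right (abs_nonneg _) (hVge1 x))
  -- equipartition: `∫ k dμ_T = 0`
  have hk0 : ∫ x, k x ∂μ = 0 := by
    have i2 : Integrable (fun x : PhaseSpace N => x.2 b ^ 2) μ :=
      (pinnedChain_memLp_two_snd hω hl.le hβ.le γ N hT b).integrable_sq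
    rw [hk]; dsimp only
    rw [integral_sub i2 (integrable_const T), integral_const, probReal_univ, one_smul,
      pinnedChain_integral_snd_sq hω hl.le hβ.le γ N hT b, sub_self]
  -- the difference of the pairings
  have hsplit : ∫ x, g₁ x * k x ∂μ - ∫ x, g₀ x * k x ∂μ = ∫ x, (D x - πD) * k x ∂μ := by
    rw [← integral_sub ig₁k ig₀k]
    have e1 : (fun x => g₁ x * k x - g₀ x * k x) = fun x => (D x - πD) * k x + πD * k x := by
      funext x; rw [hD]; dsimp only; ring
    have iDπk : Integrable (fun x => (D x - πD) * k x) μ :=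
      (iDk.sub ick).congr (ae_of_all _ fun x => by simp only [Pi.sub_apply]; ring)
    rw [e1, integral_add iDπk ick, integral_const_mul, hk0, mul_zero, add_zero]
  rw [hsplit]
  have iDπk : Integrable (fun x => (D x - πD) * k x) μ :=
    (iDk.sub ick).congr (ae_of_all _ fun x => by simp only [Pi.sub_apply]; ring)
  calc |∫ x, (D x - πD) * k x ∂μ| ≤ ∫ x, |(D x - πD) * k x| ∂μ := abs_integral_le_integral_abs
    _ ≤ ∫ x, CH * eE * W x ∂μ := by
        refine integral_mono iDπk.abs (hWi.const_mul _) fun x => ?_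
        rw [abs_mul, hW]; dsimp only
        rw [← mul_assoc]
        exact mul_le_mul_of_nonneg_right (hcent x) (abs_nonneg _)
    _ = CH * eE * ∫ x, W x ∂μ := integral_const_mul _ _
    _ = CH * eE * ∫ x, Real.exp (θ * H x) * |x.2 b ^ 2 - T| ∂μ := by
        congr 1
        exact integral_congr_ae (ae_of_all _ fun x => by rw [hW]; dsimp only; rw [hVreal])


/-! ## Registered helper -/

/-- Registered helper sub-goal `helper_flipMildContinuityDifference` of stub `stub_flipMildContinuity` (line
`fekete-usc-one-length`, crux stmt-AtomisticToContinuum-11976). The file's main theorem `mild_difference_pairing_le` has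
a statement too long for a one-line registration; the registered restatement is its flip-average lemma
`abs_flipAverage_le` (notation-free one-line form). -/
theorem helper_flipMildContinuityDifference : ∀ (ω₂ lam β γ : ℝ) (N : ℕ), 0 < N → ∀ (h : Literature.MathematicalPhysics.KineticTheory.HeatConduction.PhaseSpace N → ℝ) (C ϑ : ℝ), (∀ z, |h z| ≤ C * Real.exp (ϑ * (Literature.MathematicalPhysics.KineticTheory.HeatConduction.pinnedChain ω₂ lam β γ).hamiltonian N z)) → ∀ y : Literature.MathematicalPhysics.KineticTheory.HeatConduction.PhaseSpace N, |(N : ℝ)⁻¹ * ∑ i : Fin N, h (Literature.MathematicalPhysics.KineticTheory.HeatConduction.momentumFlip i y)| ≤ C * Real.exp (ϑ * (Literature.MathematicalPhysics.KineticTheory.HeatConduction.pinnedChain ω₂ lam β γ).hamiltonian N y) :=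
  fun _ _ _ _ _ hN _ _ _ hb y => abs_flipAverage_le hN hb y

end Summit.AtomisticToContinuum.FouriersLaw.Theorems.VanishingNoiseBound

end
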